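import Mathlib.Tactic
import HarnessLib

/-!
# Kozma–Nitzan's Question 8 — THEOREM K^ψ for ALL depths (gen 46): the cut lemmas and the decomposition behind the F-STEP certificate

Support file (`--supports stmt-CriticalPhenomena-4575`, closed crux; independent mathematics on Kozma–Nitzan's Question 8,
arXiv:2401.12397 §5.5 p. 36), prover `prim-ineq-gen-6` (gen 46).  No definitions, no named facts, no sorries; standard axioms.
Memo `run/shared/lean/prim/prim-ineq-gen-6/PROOF-KPSI-ALLJ-G46.md`.

THEOREM K^ψ (all j, either sign of c): for every path-end block `T` and every class `j`,
`E_j(T) = Σ_{k<j} ω_k φ_k + S_j φ_j ≥ 0` (`φ_k = a_kγ_k[(K₄+Φσ)p_k − Φσ] − c p_k n_k` the per-class slack), equivalently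
`K^ψ_j ≥ 0`, hence THEOREM UB(Ψ̂): `Ψ̂_j ≤ c·μ̂^_j` for all `j`.  The proof is an induction on the number of vertices whose step
(F-STEP) is ONE polynomial inequality in 10 variables certified exactly (2 242 positive rational multipliers, residual with 33 875
nonnegative Bernstein coefficients; kit job, evidence on the item).  The kernels below are the algebraic facts the step uses:
(1) `kKpsi_class_transport` — the per-class slack of `T` at a class of the suffix `T₁` with data `(α, κ, p)` is an explicit linear
form in the capped coordinates `(M,H,U,V) = (ακp, ακ(1−p), κ(1−α)p, α(1−κ)p)` (so `E_j(T) = (1−s₁)φ₀ + s₁·L̃(κ_{j−1}(T₁))` and the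
induction hypothesis `E_{j−1}(T₁[a,g]) ≥ 0` is a linear constraint on the same vector);
(2) `kCut_pH` — the cut `p₁·H ≤ (1−p₁)·M` class by class (`p_k ≥ p₁ = Φ(T₁)`);
(3) `kCut_tail` — the tail bound `π(T₁) ≤ M + U` (full single-colour mass ≤ capped one) from `π(T_{j+1}) ≤ Φ(T_{j+1})`;
(4) `kExcl_pair`, `kExcl_diag`, `kExcl_defect` — the EXCLUSIVITY lemma `U·V ≤ M·(1 − M − H − U − V)` for every capped vector
(pairwise inequality along the monotone chain of cumulative marks; equality for a single vertex with `p = 1`).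
[cite: KozmaNitzan2024, Question 8 (§5.5 p. 36)]
-/

namespace Summit.CriticalPhenomena.PercolationContinuityZ3.Theorems

namespace PocketCert

/-- **Class transport (decomposition behind F-STEP).**  A class of the suffix `T₁` with cumulative marks `α, κ` and
rest-probability `p` is a class of `T = b₀(a,g) –s₁– T₁` with marks `aα, gκ` and the same `p`; its slack
`φ = (aα)(gκ)[(K₄+Φσ)p − Φσ] − c·p·(aα + gκ − 2aαgκ)` equals the linear form
`K₄·ag·M − Φσ·ag·H − c·(g·U + a·V + (a+g−2ag)·M)` in `M = ακp`, `H = ακ(1−p)`, `U = κ(1−α)p`, `V = α(1−κ)p`.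
[cite: KozmaNitzan2024, Question 8 (§5.5 p. 36)] -/
theorem kKpsi_class_transport (a g α κ p K₄ Φσ c M H U V : ℝ)
    (hM : M = α * κ * p) (hH : H = α * κ * (1 - p)) (hU : U = κ * (1 - α) * p) (hV : V = α * (1 - κ) * p) :
    (a * α) * (g * κ) * ((K₄ + Φσ) * p - Φσ) - c * p * (a * α + g * κ - 2 * (a * α) * (g * κ))
      = K₄ * (a * g) * M - Φσ * (a * g) * H - c * (g * U + a * V + (a + g - 2 * a * g) * M) := by
  subst hM hH hU hV; ring

/-- **Cut `p₁H ≤ (1−p₁)M`, class by class.**  If a class has `ακ ≥ 0` and rest-probability `p ≥ p₁` (every class of `T₁` has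
`p_k = Φ(T_{k+2}) ≥ Φ(T₁) = p₁`), then `p₁·ακ(1−p) ≤ (1−p₁)·ακp`; summing with the (nonnegative) class weights gives the cut.
[cite: KozmaNitzan2024, Question 8 (§5.5 p. 36)] -/
theorem kCut_pH (α κ p p₁ : ℝ) (hak : 0 ≤ α * κ) (hp : p₁ ≤ p) :
    p₁ * (α * κ * (1 - p)) ≤ (1 - p₁) * (α * κ * p) := by
  nlinarith [mul_le_mul_of_nonneg_left hp hak]

/-- **Tail bound (cut `M + U ≥ π₁`).**  Write the full single-colour mass of `T₁` as `π₁ = head + ω_j·x_j + tail` (classes `< j`,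
class `j`, classes `> j`, with `x_j = κ_j p_j`) and the capped one as `M + U = head + S_j·x_j` with `S_j = ω_j + S_{j+1}`.
Since the tail is the C-mass of the suffix below class `j`, `tail ≤ S_{j+1}·κ_j·p_j` (`π(T') ≤ Φ(T')` for that suffix), hence
`π₁ ≤ M + U`.  The same with `α` gives `ε₁ ≤ M + V`.  [cite: KozmaNitzan2024, Question 8 (§5.5 p. 36)] -/
theorem kCut_tail (head ωj Sj1 xj tail : ℝ) (htail : tail ≤ Sj1 * xj) :
    head + ωj * xj + tail ≤ head + (ωj + Sj1) * xj := by
  nlinarith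

/-- **Exclusivity, pairwise kernel.**  For two classes `k < l` of a monotone chain (`α_l = α x`, `κ_l = κ y`, `x, y ∈ [0,1]`,
rest-probabilities `p, q ≥ 0`) put `U = κ(1−α)p`, `V = α(1−κ)p`, `M = ακp`, `δ̂ = (1−α)(1−κ)p` and the same primed for class `l`.
Then `U V' + U' V ≤ M δ̂' + M' δ̂` — indeed the difference is `ακ·p·q·(1−x)(1−y) ≥ 0`.
[cite: KozmaNitzan2024, Question 8 (§5.5 p. 36)] -/
theorem kExcl_pair (α κ x y p q : ℝ) (hα : 0 ≤ α) (hκ : 0 ≤ κ) (hx : x ≤ 1) (hy : y ≤ 1) (hp : 0 ≤ p) (hq : 0 ≤ q) :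
    (κ * (1 - α) * p) * ((α * x) * (1 - κ * y) * q) + ((κ * y) * (1 - α * x) * q) * (α * (1 - κ) * p)
      ≤ (α * κ * p) * ((1 - α * x) * (1 - κ * y) * q) + ((α * x) * (κ * y) * q) * ((1 - α) * (1 - κ) * p) := by
  have key : (α * κ * p) * ((1 - α * x) * (1 - κ * y) * q) + ((α * x) * (κ * y) * q) * ((1 - α) * (1 - κ) * p)
      - ((κ * (1 - α) * p) * ((α * x) * (1 - κ * y) * q) + ((κ * y) * (1 - α * x) * q) * (α * (1 - κ) * p))
      = α * κ * (p * q) * ((1 - x) * (1 - y)) := by ring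
  have h : 0 ≤ α * κ * (p * q) * ((1 - x) * (1 - y)) :=
    mul_nonneg (mul_nonneg (mul_nonneg hα hκ) (mul_nonneg hp hq)) (mul_nonneg (by linarith) (by linarith))
  linarith [key, h]

/-- **Exclusivity, diagonal kernel.**  For one class: `U·V = M·δ̂` exactly (`U = κ(1−α)p`, `V = α(1−κ)p`, `M = ακp`,
`δ̂ = (1−α)(1−κ)p`).  [cite: KozmaNitzan2024, Question 8 (§5.5 p. 36)] -/
theorem kExcl_diag (α κ p : ℝ) :
    (κ * (1 - α) * p) * (α * (1 - κ) * p) = (α * κ * p) * ((1 - α) * (1 - κ) * p) := by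
  ring

/-- **Exclusivity, defect kernel.**  Per class the deficiency `1 − M(α,κ)p − ακ(1−p)` of the capped vector dominates `δ̂ = (1−α)(1−κ)p`:
the difference is `(1−p)(1−ακ) ≥ 0`.  Summing `kExcl_pair` (pairs), `kExcl_diag` (diagonal) with the class weights gives
`U·V ≤ M·Σwδ̂ ≤ M·(1 − M − H − U − V)` for every capped vector.  [cite: KozmaNitzan2024, Question 8 (§5.5 p. 36)] -/
theorem kExcl_defect (α κ p : ℝ) (hα1 : α ≤ 1) (hκ : 0 ≤ κ) (hκ1 : κ ≤ 1) (hp1 : p ≤ 1) :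
    (1 - α) * (1 - κ) * p ≤ 1 - (α + κ - α * κ) * p - α * κ * (1 - p) := by
  have key : 1 - (α + κ - α * κ) * p - α * κ * (1 - p) - (1 - α) * (1 - κ) * p = (1 - p) * (1 - α * κ) := by ring
  have h : 0 ≤ (1 - p) * (1 - α * κ) := mul_nonneg (by linarith) (by nlinarith [mul_le_mul hα1 hκ1 hκ (by norm_num : (0:ℝ) ≤ 1)])
  linarith

/-- **Exclusivity, aggregation over two weighted classes (the pattern of the general sum).**  With weights `w, w' ≥ 0`:
`(wU + w'U')(wV + w'V') ≤ (wM + w'M')(wδ̂ + w'δ̂')` follows from the diagonal and pairwise kernels.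
[cite: KozmaNitzan2024, Question 8 (§5.5 p. 36)] -/
theorem kExcl_two (w w' U V M d U' V' M' d' : ℝ) (hw : 0 ≤ w) (hw' : 0 ≤ w')
    (hdiag : U * V ≤ M * d) (hdiag' : U' * V' ≤ M' * d') (hpair : U * V' + U' * V ≤ M * d' + M' * d) :
    (w * U + w' * U') * (w * V + w' * V') ≤ (w * M + w' * M') * (w * d + w' * d') := by
  have e : (w * M + w' * M') * (w * d + w' * d') - (w * U + w' * U') * (w * V + w' * V')
      = w ^ 2 * (M * d - U * V) + w' ^ 2 * (M' * d' - U' * V') + w * w' * (M * d' + M' * d - (U * V' + U' * V)) := by ring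
  nlinarith [sq_nonneg w, sq_nonneg w', mul_nonneg hw hw', e]

end PocketCert

end Summit.CriticalPhenomena.PercolationContinuityZ3.Theorems
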